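/-
Copyright: b2b-lace packet (LEAN TYPING SEAT 1 gen 37, node KU-SEP-MUNIFORM-ENVELOPE at `d := 10`: the m-UNIFORM
far axis rows of the column `K_{N,0}`, `|m| ≥ 6`, `N = 2, 3, 4`, by the ENVELOPE device of
`SrwTwistMUniformEnvelope` (truncation order `J = 1` at `β ≤ 15`, `J = 2` at `β ≥ 20`) at the six abscissae of the
certified trigonometric majorant `gset`).  What-if / input-certification lane at `d := 10`; nothing here is a certificate of record.
-/
import Literature.Probability.FitznerVanDerHofstad2017.SrwTwistMUniformEnvelope
import Literature.Probability.FitznerVanDerHofstad2017.SrwKZeroFarRowsD10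
import Literature.Probability.FitznerVanDerHofstad2017.SrwTrigMajorantEncl
import Literature.Probability.FitznerVanDerHofstad2017.SrwRegionSplitAxisCells
import Literature.Probability.FitznerVanDerHofstad2017.SrwIntegralMonotone
import Literature.Probability.FitznerVanDerHofstad2017.SrwITableD10Origin
import Literature.Probability.FitznerVanDerHofstad2017.SrwSeedEnclD10ClassesX
import Literature.Probability.FitznerVanDerHofstad2017.SrwSeedEnclD10ClassesY
import Literature.Analysis.FunctionSpaces.BesselJLiteralCertTable
import HarnessLib

/-!
# `K_{N,0}(m e_i; 10)` for EVERY `|m| ≥ 6` at once (`N = 2, 3, 4`): the far axis rows by the `J ≤ 2` ENVELOPE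

CITATION HEADER (PLACEMENT v2). Part of the certified REPRODUCTION of the numerical inputs of
R. Fitzner, R. van der Hofstad, *Generalized approach to the non-backtracking lace expansion*,
Probab. Theory Related Fields 169 (2017) 1041–1119 [NoBLE17-I] (arXiv:1506.07969): the SRW Fourier
integrals `I_{n,l}` (5.1) p. 1090 and `K_{n,l}(x) = ∫ D̂^l Ĉ^n cos(k·x)` (5.15) p. 1092, evaluated through
Bessel rows §5.1.1 (5.2)–(5.5) pp. 1089–1090 (the notebook `SRW.nb`); Bessel facts from NIST DLMF §10.2.2,
§10.14.4, §10.35.2 [DLMF].  Nothing in this file is a claim of the paper beyond those formulas; everything below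
is PROVED (standard axioms) from landed tree modules.

## What this module adds

`SrwKZeroFarRowsD10` bounds the far axis `|m| ≥ 6` of `K_{N,0}(m e_i; 10)` (`N = 1, 2, 3`) through the `J = 0`
m-uniform device, whose error carries the full first Bessel order tail `2δ_0(β/d)` and is too large at `N = 4`.
This module replaces the device by the ENVELOPE of `SrwTwistMUniformEnvelope`
(`abs_srwTwist_sub_lit_pow_mul_srwI_le_envelope_twoLevel_cast`) at truncation order `J = 1` for `β ∈ {5, 10, 15}`
and `J = 2` for `β ∈ {20, 25, 30}` (the per-abscissa optimum at `N = 3, 4` among `J ≤ 4` with these seeds): the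
orders `j ≤ J` of the Bessel row enter EXACTLY through the multinomial expansion of the row-truncated object over
the count vectors `k : Fin (J+1) → ℕ`, `Σ k_j = 10`, each profile seed bounded m-UNIFORMLY by the two-level table
`farI N` of `SrwKZeroFarRowsD10` (classes `[6]`, `[1,6]`, `[1,1,6,6]` by the number of nonzero coordinates),
and only the tail `Σ_{l≥0}|J_{l+J+1}(β/d)| ≤ deltaJB‹β›` (`besselTailJQ J`, orders `J+1 … 16` from the 24-digit
tables `JLit.jlitY05 … jlitY30`, the rest geometric) is paid at the coarse two-level seeds:

* `FarRowEnvD10.srwK_zero_farEnv_d10_n2 / _n3 / _n4`: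
  `6 ≤ |m| → K_{N,0}(m e_i; 10) ≤ A_N` for every axis `i`, with
  `A_2 = 221323 / 10⁶`, `A_3 = 277730 / 10⁶`, `A_4 = 470660 / 10⁶` (the literal right-hand sides of the three theorems;
  the `J = 0` rows of `SrwKZeroFarRowsD10` are `221423 / 10⁶`, `286086 / 10⁶` and — at `N = 4` — none).

Route (all ingredients landed, by name; identical to `SrwKZeroFarRowsD10` but for the device):
`SrwTrigMajorantEncl.srwK_zero_single_le_uniform_gset_cast` (`M = 6`; origin enclosure `SrwITableD10Origin`; plain
seeds `12 e_0 ≤ [6]`, `6e_0 + 6e_1 ≤ [1,6]`), and at the six abscissae `β_r = 5r + 5` the bounds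
`|Tw_N(m e_0; β_r) − p_0^{10} · I_{N,0}(0)| ≤ envEB‹β_r› N` for ALL `|m| ≥ 6`, `envEB‹β› N = envBoundQ 10 J pTabB‹β›
10⁻²⁴ deltaJB‹β› (ITableD10.tabHi N 0) (farI N)` (`J = 1, 1, 1, 2, 2, 2`) a CLOSED RATIONAL TERM (no decimal value is asserted for it;
`pTabB‹β› j = Q_j/10²⁴` the table literals).  The three row literals `A_N` are certified against the assembled
rational bound by `decide +kernel`.

This is an INPUT-CERTIFICATION module: it fixes `d = 10` only inside namespace `FarRowEnvD10`, asserts nothing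
about any bootstrap and instantiates no `…Of` certificate.  Epistemic status / lane: what-if /
input-certification at `d := 10`; nothing here is a certificate of record; no dimension sentence.

## References
* R. Fitzner, R. van der Hofstad, *Generalized approach to the non-backtracking lace expansion*,
  Probab. Theory Related Fields 169 (2017) 1041–1119, §5.1 pp. 1089–1093. [FitznerVanDerHofstad2016NoBLE]
* NIST Digital Library of Mathematical Functions, §10.2.2, §10.14.4, §10.35.2. [DLMF]
-/

namespace Literature.Probability.FitznerVanDerHofstad2017

open _root_.MeasureTheory Finset
open scoped BigOperators Nat
open Literature.Analysis.FunctionSpaces (besselJ)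
open Literature.Analysis.FunctionSpaces.JLit
open TrigEncl SeedCert

namespace FarRowEnvD10

/-! ### §1. The scalar inputs at `d := 10`, `M = 6`, `J = 1` (`β ≤ 15`) / `J = 2` (`β ≥ 20`) -/

/-- `p_j = Q_j/10²⁴`, the 24-digit literals of `J_j(1 / 2)` (`JLit.jlitY05`, `j < 17`). [cite: DLMF, §10.2.2] -/
def pTabB05 : ℕ → ℚ := fun j => (jlitY05.Q j : ℚ) / 10 ^ 24

/-- The order-tail bound `Σ_{l≥0}|J_{l+2}(1 / 2)| ≤ deltaJB05` from the table `JLit.jlitY05` (`besselTailJQ 1`).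
[cite: DLMF, §10.14.4] -/
def deltaJB05 : ℚ := besselTailJQ 1 (1 / 2) jlitY05.Q

/-- `p_j = Q_j/10²⁴`, the 24-digit literals of `J_j(1)` (`JLit.jlitY10`, `j < 17`). [cite: DLMF, §10.2.2] -/
def pTabB10 : ℕ → ℚ := fun j => (jlitY10.Q j : ℚ) / 10 ^ 24

/-- The order-tail bound `Σ_{l≥0}|J_{l+2}(1)| ≤ deltaJB10` from the table `JLit.jlitY10` (`besselTailJQ 1`).
[cite: DLMF, §10.14.4] -/
def deltaJB10 : ℚ := besselTailJQ 1 (1) jlitY10.Q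

/-- `p_j = Q_j/10²⁴`, the 24-digit literals of `J_j(3 / 2)` (`JLit.jlitY15`, `j < 17`). [cite: DLMF, §10.2.2] -/
def pTabB15 : ℕ → ℚ := fun j => (jlitY15.Q j : ℚ) / 10 ^ 24

/-- The order-tail bound `Σ_{l≥0}|J_{l+2}(3 / 2)| ≤ deltaJB15` from the table `JLit.jlitY15` (`besselTailJQ 1`).
[cite: DLMF, §10.14.4] -/
def deltaJB15 : ℚ := besselTailJQ 1 (3 / 2) jlitY15.Q

/-- `p_j = Q_j/10²⁴`, the 24-digit literals of `J_j(2)` (`JLit.jlitY20`, `j < 17`). [cite: DLMF, §10.2.2] -/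
def pTabB20 : ℕ → ℚ := fun j => (jlitY20.Q j : ℚ) / 10 ^ 24

/-- The order-tail bound `Σ_{l≥0}|J_{l+3}(2)| ≤ deltaJB20` from the table `JLit.jlitY20` (`besselTailJQ 2`).
[cite: DLMF, §10.14.4] -/
def deltaJB20 : ℚ := besselTailJQ 2 (2) jlitY20.Q

/-- `p_j = Q_j/10²⁴`, the 24-digit literals of `J_j(5 / 2)` (`JLit.jlitY25`, `j < 17`). [cite: DLMF, §10.2.2] -/
def pTabB25 : ℕ → ℚ := fun j => (jlitY25.Q j : ℚ) / 10 ^ 24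

/-- The order-tail bound `Σ_{l≥0}|J_{l+3}(5 / 2)| ≤ deltaJB25` from the table `JLit.jlitY25` (`besselTailJQ 2`).
[cite: DLMF, §10.14.4] -/
def deltaJB25 : ℚ := besselTailJQ 2 (5 / 2) jlitY25.Q

/-- `p_j = Q_j/10²⁴`, the 24-digit literals of `J_j(3)` (`JLit.jlitY30`, `j < 17`). [cite: DLMF, §10.2.2] -/
def pTabB30 : ℕ → ℚ := fun j => (jlitY30.Q j : ℚ) / 10 ^ 24

/-- The order-tail bound `Σ_{l≥0}|J_{l+3}(3)| ≤ deltaJB30` from the table `JLit.jlitY30` (`besselTailJQ 2`).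
[cite: DLMF, §10.14.4] -/
def deltaJB30 : ℚ := besselTailJQ 2 (3) jlitY30.Q

/-- The envelope device error at `β = 5` (`y = 1 / 2`), `J = 1`, `M = 6`, order `N`: a closed rational term.
[cite: FitznerVanDerHofstad2016NoBLE, §5.1.1 (5.2)–(5.5) pp. 1089–1090] -/
def envEB05 (N : ℕ) : ℚ :=
  envBoundQ 10 1 pTabB05 (1 / 10 ^ 24) deltaJB05 (ITableD10.tabHi N 0) (FarRowD10.farI N)

/-- The envelope device error at `β = 10` (`y = 1`), `J = 1`, `M = 6`, order `N`: a closed rational term.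
[cite: FitznerVanDerHofstad2016NoBLE, §5.1.1 (5.2)–(5.5) pp. 1089–1090] -/
def envEB10 (N : ℕ) : ℚ :=
  envBoundQ 10 1 pTabB10 (1 / 10 ^ 24) deltaJB10 (ITableD10.tabHi N 0) (FarRowD10.farI N)

/-- The envelope device error at `β = 15` (`y = 3 / 2`), `J = 1`, `M = 6`, order `N`: a closed rational term.
[cite: FitznerVanDerHofstad2016NoBLE, §5.1.1 (5.2)–(5.5) pp. 1089–1090] -/
def envEB15 (N : ℕ) : ℚ :=
  envBoundQ 10 1 pTabB15 (1 / 10 ^ 24) deltaJB15 (ITableD10.tabHi N 0) (FarRowD10.farI N)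

/-- The envelope device error at `β = 20` (`y = 2`), `J = 2`, `M = 6`, order `N`: a closed rational term.
[cite: FitznerVanDerHofstad2016NoBLE, §5.1.1 (5.2)–(5.5) pp. 1089–1090] -/
def envEB20 (N : ℕ) : ℚ :=
  envBoundQ 10 2 pTabB20 (1 / 10 ^ 24) deltaJB20 (ITableD10.tabHi N 0) (FarRowD10.farI N)

/-- The envelope device error at `β = 25` (`y = 5 / 2`), `J = 2`, `M = 6`, order `N`: a closed rational term.
[cite: FitznerVanDerHofstad2016NoBLE, §5.1.1 (5.2)–(5.5) pp. 1089–1090] -/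
def envEB25 (N : ℕ) : ℚ :=
  envBoundQ 10 2 pTabB25 (1 / 10 ^ 24) deltaJB25 (ITableD10.tabHi N 0) (FarRowD10.farI N)

/-- The envelope device error at `β = 30` (`y = 3`), `J = 2`, `M = 6`, order `N`: a closed rational term.
[cite: FitznerVanDerHofstad2016NoBLE, §5.1.1 (5.2)–(5.5) pp. 1089–1090] -/
def envEB30 (N : ℕ) : ℚ :=
  envBoundQ 10 2 pTabB30 (1 / 10 ^ 24) deltaJB30 (ITableD10.tabHi N 0) (FarRowD10.farI N)

/-! ### §2. The hypotheses of the device -/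

/-- `|p_j − J_j(5/10)| ≤ 10⁻²⁴` for `j ≤ 1` in the device's shape. [cite: DLMF, §10.2.2] -/
private theorem hp_b05 : ∀ j : ℕ, j ≤ 1 →
    |((pTabB05 j : ℚ) : ℝ) - besselJ j ((5 : ℝ) / ((10 : ℕ) : ℝ))| ≤ (((1 / 10 ^ 24 : ℚ)) : ℝ) := by
  intro j hj
  have h := abs_jlitY05_sub_besselJ_le_of_eq (x := (5 : ℝ) / ((10 : ℕ) : ℝ)) (by norm_num) (j := j) (by omega)
  have e1 : ((pTabB05 j : ℚ) : ℝ) = ((jlitY05.Q j : ℤ) : ℝ) / (10 ^ 24 : ℝ) := by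
    unfold pTabB05
    push_cast
    ring
  have e2 : (((1 / 10 ^ 24 : ℚ)) : ℝ) = 1 / 10 ^ 24 := by norm_num
  rw [e1, e2]
  exact h

/-- `|p_j − J_j(10/10)| ≤ 10⁻²⁴` for `j ≤ 1` in the device's shape. [cite: DLMF, §10.2.2] -/
private theorem hp_b10 : ∀ j : ℕ, j ≤ 1 →
    |((pTabB10 j : ℚ) : ℝ) - besselJ j ((10 : ℝ) / ((10 : ℕ) : ℝ))| ≤ (((1 / 10 ^ 24 : ℚ)) : ℝ) := by
  intro j hj
  have h := abs_jlitY10_sub_besselJ_le_of_eq (x := (10 : ℝ) / ((10 : ℕ) : ℝ)) (by norm_num) (j := j) (by omega)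
  have e1 : ((pTabB10 j : ℚ) : ℝ) = ((jlitY10.Q j : ℤ) : ℝ) / (10 ^ 24 : ℝ) := by
    unfold pTabB10
    push_cast
    ring
  have e2 : (((1 / 10 ^ 24 : ℚ)) : ℝ) = 1 / 10 ^ 24 := by norm_num
  rw [e1, e2]
  exact h

/-- `|p_j − J_j(15/10)| ≤ 10⁻²⁴` for `j ≤ 1` in the device's shape. [cite: DLMF, §10.2.2] -/
private theorem hp_b15 : ∀ j : ℕ, j ≤ 1 →
    |((pTabB15 j : ℚ) : ℝ) - besselJ j ((15 : ℝ) / ((10 : ℕ) : ℝ))| ≤ (((1 / 10 ^ 24 : ℚ)) : ℝ) := by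
  intro j hj
  have h := abs_jlitY15_sub_besselJ_le_of_eq (x := (15 : ℝ) / ((10 : ℕ) : ℝ)) (by norm_num) (j := j) (by omega)
  have e1 : ((pTabB15 j : ℚ) : ℝ) = ((jlitY15.Q j : ℤ) : ℝ) / (10 ^ 24 : ℝ) := by
    unfold pTabB15
    push_cast
    ring
  have e2 : (((1 / 10 ^ 24 : ℚ)) : ℝ) = 1 / 10 ^ 24 := by norm_num
  rw [e1, e2]
  exact h

/-- `|p_j − J_j(20/10)| ≤ 10⁻²⁴` for `j ≤ 2` in the device's shape. [cite: DLMF, §10.2.2] -/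
private theorem hp_b20 : ∀ j : ℕ, j ≤ 2 →
    |((pTabB20 j : ℚ) : ℝ) - besselJ j ((20 : ℝ) / ((10 : ℕ) : ℝ))| ≤ (((1 / 10 ^ 24 : ℚ)) : ℝ) := by
  intro j hj
  have h := abs_jlitY20_sub_besselJ_le_of_eq (x := (20 : ℝ) / ((10 : ℕ) : ℝ)) (by norm_num) (j := j) (by omega)
  have e1 : ((pTabB20 j : ℚ) : ℝ) = ((jlitY20.Q j : ℤ) : ℝ) / (10 ^ 24 : ℝ) := by
    unfold pTabB20
    push_cast
    ring
  have e2 : (((1 / 10 ^ 24 : ℚ)) : ℝ) = 1 / 10 ^ 24 := by norm_num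
  rw [e1, e2]
  exact h

/-- `|p_j − J_j(25/10)| ≤ 10⁻²⁴` for `j ≤ 2` in the device's shape. [cite: DLMF, §10.2.2] -/
private theorem hp_b25 : ∀ j : ℕ, j ≤ 2 →
    |((pTabB25 j : ℚ) : ℝ) - besselJ j ((25 : ℝ) / ((10 : ℕ) : ℝ))| ≤ (((1 / 10 ^ 24 : ℚ)) : ℝ) := by
  intro j hj
  have h := abs_jlitY25_sub_besselJ_le_of_eq (x := (25 : ℝ) / ((10 : ℕ) : ℝ)) (by norm_num) (j := j) (by omega)
  have e1 : ((pTabB25 j : ℚ) : ℝ) = ((jlitY25.Q j : ℤ) : ℝ) / (10 ^ 24 : ℝ) := by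
    unfold pTabB25
    push_cast
    ring
  have e2 : (((1 / 10 ^ 24 : ℚ)) : ℝ) = 1 / 10 ^ 24 := by norm_num
  rw [e1, e2]
  exact h

/-- `|p_j − J_j(30/10)| ≤ 10⁻²⁴` for `j ≤ 2` in the device's shape. [cite: DLMF, §10.2.2] -/
private theorem hp_b30 : ∀ j : ℕ, j ≤ 2 →
    |((pTabB30 j : ℚ) : ℝ) - besselJ j ((30 : ℝ) / ((10 : ℕ) : ℝ))| ≤ (((1 / 10 ^ 24 : ℚ)) : ℝ) := by
  intro j hj
  have h := abs_jlitY30_sub_besselJ_le_of_eq (x := (30 : ℝ) / ((10 : ℕ) : ℝ)) (by norm_num) (j := j) (by omega)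
  have e1 : ((pTabB30 j : ℚ) : ℝ) = ((jlitY30.Q j : ℤ) : ℝ) / (10 ^ 24 : ℝ) := by
    unfold pTabB30
    push_cast
    ring
  have e2 : (((1 / 10 ^ 24 : ℚ)) : ℝ) = 1 / 10 ^ 24 := by norm_num
  rw [e1, e2]
  exact h

/-- `Σ_{l≥0} |J_{l+2}(5/10)| ≤ deltaJB05`. [cite: DLMF, §10.14.4] -/
private theorem hdeltaJ_b05 :
    ∑' l : ℕ, |besselJ (l + 1 + 1) ((5 : ℝ) / ((10 : ℕ) : ℝ))| ≤ ((deltaJB05 : ℚ) : ℝ) := by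
  have h := tsum_abs_besselJ_orderTail_le_besselTailJQ (J := 1) (by norm_num) (Y := 1 / 2) (by norm_num)
    (by norm_num) (Q := jlitY05.Q) (fun j hj => abs_jlitY05_sub_besselJ_le_of_eq (by norm_num) hj)
  have e : (((1 / 2 : ℚ)) : ℝ) = (5 : ℝ) / ((10 : ℕ) : ℝ) := by norm_num
  rw [e] at h
  exact h

/-- `Σ_{l≥0} |J_{l+2}(10/10)| ≤ deltaJB10`. [cite: DLMF, §10.14.4] -/
private theorem hdeltaJ_b10 :
    ∑' l : ℕ, |besselJ (l + 1 + 1) ((10 : ℝ) / ((10 : ℕ) : ℝ))| ≤ ((deltaJB10 : ℚ) : ℝ) := by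
  have h := tsum_abs_besselJ_orderTail_le_besselTailJQ (J := 1) (by norm_num) (Y := 1) (by norm_num)
    (by norm_num) (Q := jlitY10.Q) (fun j hj => abs_jlitY10_sub_besselJ_le_of_eq (by norm_num) hj)
  have e : (((1 : ℚ)) : ℝ) = (10 : ℝ) / ((10 : ℕ) : ℝ) := by norm_num
  rw [e] at h
  exact h

/-- `Σ_{l≥0} |J_{l+2}(15/10)| ≤ deltaJB15`. [cite: DLMF, §10.14.4] -/
private theorem hdeltaJ_b15 :
    ∑' l : ℕ, |besselJ (l + 1 + 1) ((15 : ℝ) / ((10 : ℕ) : ℝ))| ≤ ((deltaJB15 : ℚ) : ℝ) := by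
  have h := tsum_abs_besselJ_orderTail_le_besselTailJQ (J := 1) (by norm_num) (Y := 3 / 2) (by norm_num)
    (by norm_num) (Q := jlitY15.Q) (fun j hj => abs_jlitY15_sub_besselJ_le_of_eq (by norm_num) hj)
  have e : (((3 / 2 : ℚ)) : ℝ) = (15 : ℝ) / ((10 : ℕ) : ℝ) := by norm_num
  rw [e] at h
  exact h

/-- `Σ_{l≥0} |J_{l+3}(20/10)| ≤ deltaJB20`. [cite: DLMF, §10.14.4] -/
private theorem hdeltaJ_b20 :
    ∑' l : ℕ, |besselJ (l + 2 + 1) ((20 : ℝ) / ((10 : ℕ) : ℝ))| ≤ ((deltaJB20 : ℚ) : ℝ) := by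
  have h := tsum_abs_besselJ_orderTail_le_besselTailJQ (J := 2) (by norm_num) (Y := 2) (by norm_num)
    (by norm_num) (Q := jlitY20.Q) (fun j hj => abs_jlitY20_sub_besselJ_le_of_eq (by norm_num) hj)
  have e : (((2 : ℚ)) : ℝ) = (20 : ℝ) / ((10 : ℕ) : ℝ) := by norm_num
  rw [e] at h
  exact h

/-- `Σ_{l≥0} |J_{l+3}(25/10)| ≤ deltaJB25`. [cite: DLMF, §10.14.4] -/
private theorem hdeltaJ_b25 :
    ∑' l : ℕ, |besselJ (l + 2 + 1) ((25 : ℝ) / ((10 : ℕ) : ℝ))| ≤ ((deltaJB25 : ℚ) : ℝ) := by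
  have h := tsum_abs_besselJ_orderTail_le_besselTailJQ (J := 2) (by norm_num) (Y := 5 / 2) (by norm_num)
    (by norm_num) (Q := jlitY25.Q) (fun j hj => abs_jlitY25_sub_besselJ_le_of_eq (by norm_num) hj)
  have e : (((5 / 2 : ℚ)) : ℝ) = (25 : ℝ) / ((10 : ℕ) : ℝ) := by norm_num
  rw [e] at h
  exact h

/-- `Σ_{l≥0} |J_{l+3}(30/10)| ≤ deltaJB30`. [cite: DLMF, §10.14.4] -/
private theorem hdeltaJ_b30 :
    ∑' l : ℕ, |besselJ (l + 2 + 1) ((30 : ℝ) / ((10 : ℕ) : ℝ))| ≤ ((deltaJB30 : ℚ) : ℝ) := by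
  have h := tsum_abs_besselJ_orderTail_le_besselTailJQ (J := 2) (by norm_num) (Y := 3) (by norm_num)
    (by norm_num) (Q := jlitY30.Q) (fun j hj => abs_jlitY30_sub_besselJ_le_of_eq (by norm_num) hj)
  have e : (((3 : ℚ)) : ℝ) = (30 : ℝ) / ((10 : ℕ) : ℝ) := by norm_num
  rw [e] at h
  exact h

/-- The two-level seeds at `M = 6`, order `2`: `I_{2,0}(6(e_0+…+e_c); 10) ≤ farI 2 c` by coordinatewise
domination (`absMonotone_srwI`) from the decided classes `[6]`, `[1,6]`, `[1,1,6,6]`. [cite: FitznerVanDerHofstad2016NoBLE, (5.1) p. 1090] -/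
private theorem hI_n2 : ∀ c ∈ Finset.range 10,
    srwI 10 2 0 (fun μ : Fin 10 => if (μ : ℕ) < c + 1 then ((6 : ℕ) : ℤ) else 0) ≤ ((FarRowD10.farI 2 c : ℚ) : ℝ) := by
  intro c hc
  rw [Finset.mem_range] at hc
  interval_cases c
  · exact (absMonotone_srwI (d := 10) (n := 2) (by norm_num) (by norm_num) 0 _ (clsPt 10 [6]) (by decide)).trans
      (srwI_seed_encl_d10_v000001 2 (by norm_num) (by norm_num)).2
  · exact (absMonotone_srwI (d := 10) (n := 2) (by norm_num) (by norm_num) 0 _ (clsPt 10 [1, 6]) (by decide)).trans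
      (srwI_seed_encl_d10_v100001 2 (by norm_num) (by norm_num)).2
  · exact (absMonotone_srwI (d := 10) (n := 2) (by norm_num) (by norm_num) 0 _ (clsPt 10 [1, 6]) (by decide)).trans
      (srwI_seed_encl_d10_v100001 2 (by norm_num) (by norm_num)).2
  · exact (absMonotone_srwI (d := 10) (n := 2) (by norm_num) (by norm_num) 0 _ (clsPt 10 [1, 1, 6, 6]) (by decide)).trans
      (srwI_seed_encl_d10_v200002 2 (by norm_num) (by norm_num)).2
  · exact (absMonotone_srwI (d := 10) (n := 2) (by norm_num) (by norm_num) 0 _ (clsPt 10 [1, 1, 6, 6]) (by decide)).trans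
      (srwI_seed_encl_d10_v200002 2 (by norm_num) (by norm_num)).2
  · exact (absMonotone_srwI (d := 10) (n := 2) (by norm_num) (by norm_num) 0 _ (clsPt 10 [1, 1, 6, 6]) (by decide)).trans
      (srwI_seed_encl_d10_v200002 2 (by norm_num) (by norm_num)).2
  · exact (absMonotone_srwI (d := 10) (n := 2) (by norm_num) (by norm_num) 0 _ (clsPt 10 [1, 1, 6, 6]) (by decide)).trans
      (srwI_seed_encl_d10_v200002 2 (by norm_num) (by norm_num)).2
  · exact (absMonotone_srwI (d := 10) (n := 2) (by norm_num) (by norm_num) 0 _ (clsPt 10 [1, 1, 6, 6]) (by decide)).trans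
      (srwI_seed_encl_d10_v200002 2 (by norm_num) (by norm_num)).2
  · exact (absMonotone_srwI (d := 10) (n := 2) (by norm_num) (by norm_num) 0 _ (clsPt 10 [1, 1, 6, 6]) (by decide)).trans
      (srwI_seed_encl_d10_v200002 2 (by norm_num) (by norm_num)).2
  · exact (absMonotone_srwI (d := 10) (n := 2) (by norm_num) (by norm_num) 0 _ (clsPt 10 [1, 1, 6, 6]) (by decide)).trans
      (srwI_seed_encl_d10_v200002 2 (by norm_num) (by norm_num)).2

/-- The two-level seeds at `M = 6`, order `3`: `I_{3,0}(6(e_0+…+e_c); 10) ≤ farI 3 c` by coordinatewise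
domination (`absMonotone_srwI`) from the decided classes `[6]`, `[1,6]`, `[1,1,6,6]`. [cite: FitznerVanDerHofstad2016NoBLE, (5.1) p. 1090] -/
private theorem hI_n3 : ∀ c ∈ Finset.range 10,
    srwI 10 3 0 (fun μ : Fin 10 => if (μ : ℕ) < c + 1 then ((6 : ℕ) : ℤ) else 0) ≤ ((FarRowD10.farI 3 c : ℚ) : ℝ) := by
  intro c hc
  rw [Finset.mem_range] at hc
  interval_cases c
  · exact (absMonotone_srwI (d := 10) (n := 3) (by norm_num) (by norm_num) 0 _ (clsPt 10 [6]) (by decide)).trans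
      (srwI_seed_encl_d10_v000001 3 (by norm_num) (by norm_num)).2
  · exact (absMonotone_srwI (d := 10) (n := 3) (by norm_num) (by norm_num) 0 _ (clsPt 10 [1, 6]) (by decide)).trans
      (srwI_seed_encl_d10_v100001 3 (by norm_num) (by norm_num)).2
  · exact (absMonotone_srwI (d := 10) (n := 3) (by norm_num) (by norm_num) 0 _ (clsPt 10 [1, 6]) (by decide)).trans
      (srwI_seed_encl_d10_v100001 3 (by norm_num) (by norm_num)).2
  · exact (absMonotone_srwI (d := 10) (n := 3) (by norm_num) (by norm_num) 0 _ (clsPt 10 [1, 1, 6, 6]) (by decide)).trans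
      (srwI_seed_encl_d10_v200002 3 (by norm_num) (by norm_num)).2
  · exact (absMonotone_srwI (d := 10) (n := 3) (by norm_num) (by norm_num) 0 _ (clsPt 10 [1, 1, 6, 6]) (by decide)).trans
      (srwI_seed_encl_d10_v200002 3 (by norm_num) (by norm_num)).2
  · exact (absMonotone_srwI (d := 10) (n := 3) (by norm_num) (by norm_num) 0 _ (clsPt 10 [1, 1, 6, 6]) (by decide)).trans
      (srwI_seed_encl_d10_v200002 3 (by norm_num) (by norm_num)).2
  · exact (absMonotone_srwI (d := 10) (n := 3) (by norm_num) (by norm_num) 0 _ (clsPt 10 [1, 1, 6, 6]) (by decide)).trans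
      (srwI_seed_encl_d10_v200002 3 (by norm_num) (by norm_num)).2
  · exact (absMonotone_srwI (d := 10) (n := 3) (by norm_num) (by norm_num) 0 _ (clsPt 10 [1, 1, 6, 6]) (by decide)).trans
      (srwI_seed_encl_d10_v200002 3 (by norm_num) (by norm_num)).2
  · exact (absMonotone_srwI (d := 10) (n := 3) (by norm_num) (by norm_num) 0 _ (clsPt 10 [1, 1, 6, 6]) (by decide)).trans
      (srwI_seed_encl_d10_v200002 3 (by norm_num) (by norm_num)).2
  · exact (absMonotone_srwI (d := 10) (n := 3) (by norm_num) (by norm_num) 0 _ (clsPt 10 [1, 1, 6, 6]) (by decide)).trans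
      (srwI_seed_encl_d10_v200002 3 (by norm_num) (by norm_num)).2

/-- The two-level seeds at `M = 6`, order `4`: `I_{4,0}(6(e_0+…+e_c); 10) ≤ farI 4 c` by coordinatewise
domination (`absMonotone_srwI`) from the decided classes `[6]`, `[1,6]`, `[1,1,6,6]`. [cite: FitznerVanDerHofstad2016NoBLE, (5.1) p. 1090] -/
private theorem hI_n4 : ∀ c ∈ Finset.range 10,
    srwI 10 4 0 (fun μ : Fin 10 => if (μ : ℕ) < c + 1 then ((6 : ℕ) : ℤ) else 0) ≤ ((FarRowD10.farI 4 c : ℚ) : ℝ) := by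
  intro c hc
  rw [Finset.mem_range] at hc
  interval_cases c
  · exact (absMonotone_srwI (d := 10) (n := 4) (by norm_num) (by norm_num) 0 _ (clsPt 10 [6]) (by decide)).trans
      (srwI_seed_encl_d10_v000001 4 (by norm_num) (by norm_num)).2
  · exact (absMonotone_srwI (d := 10) (n := 4) (by norm_num) (by norm_num) 0 _ (clsPt 10 [1, 6]) (by decide)).trans
      (srwI_seed_encl_d10_v100001 4 (by norm_num) (by norm_num)).2
  · exact (absMonotone_srwI (d := 10) (n := 4) (by norm_num) (by norm_num) 0 _ (clsPt 10 [1, 6]) (by decide)).trans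
      (srwI_seed_encl_d10_v100001 4 (by norm_num) (by norm_num)).2
  · exact (absMonotone_srwI (d := 10) (n := 4) (by norm_num) (by norm_num) 0 _ (clsPt 10 [1, 1, 6, 6]) (by decide)).trans
      (srwI_seed_encl_d10_v200002 4 (by norm_num) (by norm_num)).2
  · exact (absMonotone_srwI (d := 10) (n := 4) (by norm_num) (by norm_num) 0 _ (clsPt 10 [1, 1, 6, 6]) (by decide)).trans
      (srwI_seed_encl_d10_v200002 4 (by norm_num) (by norm_num)).2
  · exact (absMonotone_srwI (d := 10) (n := 4) (by norm_num) (by norm_num) 0 _ (clsPt 10 [1, 1, 6, 6]) (by decide)).trans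
      (srwI_seed_encl_d10_v200002 4 (by norm_num) (by norm_num)).2
  · exact (absMonotone_srwI (d := 10) (n := 4) (by norm_num) (by norm_num) 0 _ (clsPt 10 [1, 1, 6, 6]) (by decide)).trans
      (srwI_seed_encl_d10_v200002 4 (by norm_num) (by norm_num)).2
  · exact (absMonotone_srwI (d := 10) (n := 4) (by norm_num) (by norm_num) 0 _ (clsPt 10 [1, 1, 6, 6]) (by decide)).trans
      (srwI_seed_encl_d10_v200002 4 (by norm_num) (by norm_num)).2
  · exact (absMonotone_srwI (d := 10) (n := 4) (by norm_num) (by norm_num) 0 _ (clsPt 10 [1, 1, 6, 6]) (by decide)).trans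
      (srwI_seed_encl_d10_v200002 4 (by norm_num) (by norm_num)).2
  · exact (absMonotone_srwI (d := 10) (n := 4) (by norm_num) (by norm_num) 0 _ (clsPt 10 [1, 1, 6, 6]) (by decide)).trans
      (srwI_seed_encl_d10_v200002 4 (by norm_num) (by norm_num)).2

/-! ### §3. The far twisted rows `|Tw_N(m e_0; β_r) − p_0^{10} I_{N,0}(0)| ≤ envEB‹β_r› N`, all `|m| ≥ 6` -/

/-- **`|Tw_2(m e_0; 5) − p_0^{10} · I_{2,0}(0)| ≤ envEB05 2`** for EVERY `|m| ≥ 6` (`d = 10`, `p_0 = pTabB05 0`,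
`J = 1`). [cite: FitznerVanDerHofstad2016NoBLE, §5.1.1 (5.2)–(5.5) pp. 1089–1090; DLMF, §10.2.2, §10.35.2] -/
theorem srwTwist_farEnv_d10_n2_b05 (m : ℤ) (hm : 6 ≤ m.natAbs) :
    |srwTwist 10 2 (fun _ => (1 : ℝ)) (Pi.single (0 : Fin 10) m) 5
        - ((pTabB05 0 ^ 10 : ℚ) : ℝ) * srwI 10 2 0 0| ≤ ((envEB05 2 : ℚ) : ℝ) := by
  have hm0 : m ≠ 0 := by
    rintro rfl
    simp at hm
  have h := abs_srwTwist_sub_lit_pow_mul_srwI_le_envelope_twoLevel_cast (d := 10) 1 (by norm_num)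
    (0 : Fin 10) hm0 (5 : ℝ) 1 6 hm hp_b05 hdeltaJ_b05 hI_n2
    (ITableD10.srwI_tab_encl_d10_origin 2 (by norm_num) 0 (by norm_num)).2
  rw [← Rat.cast_pow] at h
  exact h

/-- **`|Tw_2(m e_0; 10) − p_0^{10} · I_{2,0}(0)| ≤ envEB10 2`** for EVERY `|m| ≥ 6` (`d = 10`, `p_0 = pTabB10 0`,
`J = 1`). [cite: FitznerVanDerHofstad2016NoBLE, §5.1.1 (5.2)–(5.5) pp. 1089–1090; DLMF, §10.2.2, §10.35.2] -/
theorem srwTwist_farEnv_d10_n2_b10 (m : ℤ) (hm : 6 ≤ m.natAbs) :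
    |srwTwist 10 2 (fun _ => (1 : ℝ)) (Pi.single (0 : Fin 10) m) 10
        - ((pTabB10 0 ^ 10 : ℚ) : ℝ) * srwI 10 2 0 0| ≤ ((envEB10 2 : ℚ) : ℝ) := by
  have hm0 : m ≠ 0 := by
    rintro rfl
    simp at hm
  have h := abs_srwTwist_sub_lit_pow_mul_srwI_le_envelope_twoLevel_cast (d := 10) 1 (by norm_num)
    (0 : Fin 10) hm0 (10 : ℝ) 1 6 hm hp_b10 hdeltaJ_b10 hI_n2
    (ITableD10.srwI_tab_encl_d10_origin 2 (by norm_num) 0 (by norm_num)).2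
  rw [← Rat.cast_pow] at h
  exact h

/-- **`|Tw_2(m e_0; 15) − p_0^{10} · I_{2,0}(0)| ≤ envEB15 2`** for EVERY `|m| ≥ 6` (`d = 10`, `p_0 = pTabB15 0`,
`J = 1`). [cite: FitznerVanDerHofstad2016NoBLE, §5.1.1 (5.2)–(5.5) pp. 1089–1090; DLMF, §10.2.2, §10.35.2] -/
theorem srwTwist_farEnv_d10_n2_b15 (m : ℤ) (hm : 6 ≤ m.natAbs) :
    |srwTwist 10 2 (fun _ => (1 : ℝ)) (Pi.single (0 : Fin 10) m) 15
        - ((pTabB15 0 ^ 10 : ℚ) : ℝ) * srwI 10 2 0 0| ≤ ((envEB15 2 : ℚ) : ℝ) := by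
  have hm0 : m ≠ 0 := by
    rintro rfl
    simp at hm
  have h := abs_srwTwist_sub_lit_pow_mul_srwI_le_envelope_twoLevel_cast (d := 10) 1 (by norm_num)
    (0 : Fin 10) hm0 (15 : ℝ) 1 6 hm hp_b15 hdeltaJ_b15 hI_n2
    (ITableD10.srwI_tab_encl_d10_origin 2 (by norm_num) 0 (by norm_num)).2
  rw [← Rat.cast_pow] at h
  exact h

/-- **`|Tw_2(m e_0; 20) − p_0^{10} · I_{2,0}(0)| ≤ envEB20 2`** for EVERY `|m| ≥ 6` (`d = 10`, `p_0 = pTabB20 0`,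
`J = 2`). [cite: FitznerVanDerHofstad2016NoBLE, §5.1.1 (5.2)–(5.5) pp. 1089–1090; DLMF, §10.2.2, §10.35.2] -/
theorem srwTwist_farEnv_d10_n2_b20 (m : ℤ) (hm : 6 ≤ m.natAbs) :
    |srwTwist 10 2 (fun _ => (1 : ℝ)) (Pi.single (0 : Fin 10) m) 20
        - ((pTabB20 0 ^ 10 : ℚ) : ℝ) * srwI 10 2 0 0| ≤ ((envEB20 2 : ℚ) : ℝ) := by
  have hm0 : m ≠ 0 := by
    rintro rfl
    simp at hm
  have h := abs_srwTwist_sub_lit_pow_mul_srwI_le_envelope_twoLevel_cast (d := 10) 1 (by norm_num)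
    (0 : Fin 10) hm0 (20 : ℝ) 2 6 hm hp_b20 hdeltaJ_b20 hI_n2
    (ITableD10.srwI_tab_encl_d10_origin 2 (by norm_num) 0 (by norm_num)).2
  rw [← Rat.cast_pow] at h
  exact h

/-- **`|Tw_2(m e_0; 25) − p_0^{10} · I_{2,0}(0)| ≤ envEB25 2`** for EVERY `|m| ≥ 6` (`d = 10`, `p_0 = pTabB25 0`,
`J = 2`). [cite: FitznerVanDerHofstad2016NoBLE, §5.1.1 (5.2)–(5.5) pp. 1089–1090; DLMF, §10.2.2, §10.35.2] -/
theorem srwTwist_farEnv_d10_n2_b25 (m : ℤ) (hm : 6 ≤ m.natAbs) :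
    |srwTwist 10 2 (fun _ => (1 : ℝ)) (Pi.single (0 : Fin 10) m) 25
        - ((pTabB25 0 ^ 10 : ℚ) : ℝ) * srwI 10 2 0 0| ≤ ((envEB25 2 : ℚ) : ℝ) := by
  have hm0 : m ≠ 0 := by
    rintro rfl
    simp at hm
  have h := abs_srwTwist_sub_lit_pow_mul_srwI_le_envelope_twoLevel_cast (d := 10) 1 (by norm_num)
    (0 : Fin 10) hm0 (25 : ℝ) 2 6 hm hp_b25 hdeltaJ_b25 hI_n2
    (ITableD10.srwI_tab_encl_d10_origin 2 (by norm_num) 0 (by norm_num)).2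
  rw [← Rat.cast_pow] at h
  exact h

/-- **`|Tw_2(m e_0; 30) − p_0^{10} · I_{2,0}(0)| ≤ envEB30 2`** for EVERY `|m| ≥ 6` (`d = 10`, `p_0 = pTabB30 0`,
`J = 2`). [cite: FitznerVanDerHofstad2016NoBLE, §5.1.1 (5.2)–(5.5) pp. 1089–1090; DLMF, §10.2.2, §10.35.2] -/
theorem srwTwist_farEnv_d10_n2_b30 (m : ℤ) (hm : 6 ≤ m.natAbs) :
    |srwTwist 10 2 (fun _ => (1 : ℝ)) (Pi.single (0 : Fin 10) m) 30
        - ((pTabB30 0 ^ 10 : ℚ) : ℝ) * srwI 10 2 0 0| ≤ ((envEB30 2 : ℚ) : ℝ) := by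
  have hm0 : m ≠ 0 := by
    rintro rfl
    simp at hm
  have h := abs_srwTwist_sub_lit_pow_mul_srwI_le_envelope_twoLevel_cast (d := 10) 1 (by norm_num)
    (0 : Fin 10) hm0 (30 : ℝ) 2 6 hm hp_b30 hdeltaJ_b30 hI_n2
    (ITableD10.srwI_tab_encl_d10_origin 2 (by norm_num) 0 (by norm_num)).2
  rw [← Rat.cast_pow] at h
  exact h

/-- **`|Tw_3(m e_0; 5) − p_0^{10} · I_{3,0}(0)| ≤ envEB05 3`** for EVERY `|m| ≥ 6` (`d = 10`, `p_0 = pTabB05 0`,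
`J = 1`). [cite: FitznerVanDerHofstad2016NoBLE, §5.1.1 (5.2)–(5.5) pp. 1089–1090; DLMF, §10.2.2, §10.35.2] -/
theorem srwTwist_farEnv_d10_n3_b05 (m : ℤ) (hm : 6 ≤ m.natAbs) :
    |srwTwist 10 3 (fun _ => (1 : ℝ)) (Pi.single (0 : Fin 10) m) 5
        - ((pTabB05 0 ^ 10 : ℚ) : ℝ) * srwI 10 3 0 0| ≤ ((envEB05 3 : ℚ) : ℝ) := by
  have hm0 : m ≠ 0 := by
    rintro rfl
    simp at hm
  have h := abs_srwTwist_sub_lit_pow_mul_srwI_le_envelope_twoLevel_cast (d := 10) 2 (by norm_num)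
    (0 : Fin 10) hm0 (5 : ℝ) 1 6 hm hp_b05 hdeltaJ_b05 hI_n3
    (ITableD10.srwI_tab_encl_d10_origin 3 (by norm_num) 0 (by norm_num)).2
  rw [← Rat.cast_pow] at h
  exact h

/-- **`|Tw_3(m e_0; 10) − p_0^{10} · I_{3,0}(0)| ≤ envEB10 3`** for EVERY `|m| ≥ 6` (`d = 10`, `p_0 = pTabB10 0`,
`J = 1`). [cite: FitznerVanDerHofstad2016NoBLE, §5.1.1 (5.2)–(5.5) pp. 1089–1090; DLMF, §10.2.2, §10.35.2] -/
theorem srwTwist_farEnv_d10_n3_b10 (m : ℤ) (hm : 6 ≤ m.natAbs) :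
    |srwTwist 10 3 (fun _ => (1 : ℝ)) (Pi.single (0 : Fin 10) m) 10
        - ((pTabB10 0 ^ 10 : ℚ) : ℝ) * srwI 10 3 0 0| ≤ ((envEB10 3 : ℚ) : ℝ) := by
  have hm0 : m ≠ 0 := by
    rintro rfl
    simp at hm
  have h := abs_srwTwist_sub_lit_pow_mul_srwI_le_envelope_twoLevel_cast (d := 10) 2 (by norm_num)
    (0 : Fin 10) hm0 (10 : ℝ) 1 6 hm hp_b10 hdeltaJ_b10 hI_n3
    (ITableD10.srwI_tab_encl_d10_origin 3 (by norm_num) 0 (by norm_num)).2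
  rw [← Rat.cast_pow] at h
  exact h

/-- **`|Tw_3(m e_0; 15) − p_0^{10} · I_{3,0}(0)| ≤ envEB15 3`** for EVERY `|m| ≥ 6` (`d = 10`, `p_0 = pTabB15 0`,
`J = 1`). [cite: FitznerVanDerHofstad2016NoBLE, §5.1.1 (5.2)–(5.5) pp. 1089–1090; DLMF, §10.2.2, §10.35.2] -/
theorem srwTwist_farEnv_d10_n3_b15 (m : ℤ) (hm : 6 ≤ m.natAbs) :
    |srwTwist 10 3 (fun _ => (1 : ℝ)) (Pi.single (0 : Fin 10) m) 15
        - ((pTabB15 0 ^ 10 : ℚ) : ℝ) * srwI 10 3 0 0| ≤ ((envEB15 3 : ℚ) : ℝ) := by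
  have hm0 : m ≠ 0 := by
    rintro rfl
    simp at hm
  have h := abs_srwTwist_sub_lit_pow_mul_srwI_le_envelope_twoLevel_cast (d := 10) 2 (by norm_num)
    (0 : Fin 10) hm0 (15 : ℝ) 1 6 hm hp_b15 hdeltaJ_b15 hI_n3
    (ITableD10.srwI_tab_encl_d10_origin 3 (by norm_num) 0 (by norm_num)).2
  rw [← Rat.cast_pow] at h
  exact h

/-- **`|Tw_3(m e_0; 20) − p_0^{10} · I_{3,0}(0)| ≤ envEB20 3`** for EVERY `|m| ≥ 6` (`d = 10`, `p_0 = pTabB20 0`,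
`J = 2`). [cite: FitznerVanDerHofstad2016NoBLE, §5.1.1 (5.2)–(5.5) pp. 1089–1090; DLMF, §10.2.2, §10.35.2] -/
theorem srwTwist_farEnv_d10_n3_b20 (m : ℤ) (hm : 6 ≤ m.natAbs) :
    |srwTwist 10 3 (fun _ => (1 : ℝ)) (Pi.single (0 : Fin 10) m) 20
        - ((pTabB20 0 ^ 10 : ℚ) : ℝ) * srwI 10 3 0 0| ≤ ((envEB20 3 : ℚ) : ℝ) := by
  have hm0 : m ≠ 0 := by
    rintro rfl
    simp at hm
  have h := abs_srwTwist_sub_lit_pow_mul_srwI_le_envelope_twoLevel_cast (d := 10) 2 (by norm_num)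
    (0 : Fin 10) hm0 (20 : ℝ) 2 6 hm hp_b20 hdeltaJ_b20 hI_n3
    (ITableD10.srwI_tab_encl_d10_origin 3 (by norm_num) 0 (by norm_num)).2
  rw [← Rat.cast_pow] at h
  exact h

/-- **`|Tw_3(m e_0; 25) − p_0^{10} · I_{3,0}(0)| ≤ envEB25 3`** for EVERY `|m| ≥ 6` (`d = 10`, `p_0 = pTabB25 0`,
`J = 2`). [cite: FitznerVanDerHofstad2016NoBLE, §5.1.1 (5.2)–(5.5) pp. 1089–1090; DLMF, §10.2.2, §10.35.2] -/
theorem srwTwist_farEnv_d10_n3_b25 (m : ℤ) (hm : 6 ≤ m.natAbs) :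
    |srwTwist 10 3 (fun _ => (1 : ℝ)) (Pi.single (0 : Fin 10) m) 25
        - ((pTabB25 0 ^ 10 : ℚ) : ℝ) * srwI 10 3 0 0| ≤ ((envEB25 3 : ℚ) : ℝ) := by
  have hm0 : m ≠ 0 := by
    rintro rfl
    simp at hm
  have h := abs_srwTwist_sub_lit_pow_mul_srwI_le_envelope_twoLevel_cast (d := 10) 2 (by norm_num)
    (0 : Fin 10) hm0 (25 : ℝ) 2 6 hm hp_b25 hdeltaJ_b25 hI_n3
    (ITableD10.srwI_tab_encl_d10_origin 3 (by norm_num) 0 (by norm_num)).2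
  rw [← Rat.cast_pow] at h
  exact h

/-- **`|Tw_3(m e_0; 30) − p_0^{10} · I_{3,0}(0)| ≤ envEB30 3`** for EVERY `|m| ≥ 6` (`d = 10`, `p_0 = pTabB30 0`,
`J = 2`). [cite: FitznerVanDerHofstad2016NoBLE, §5.1.1 (5.2)–(5.5) pp. 1089–1090; DLMF, §10.2.2, §10.35.2] -/
theorem srwTwist_farEnv_d10_n3_b30 (m : ℤ) (hm : 6 ≤ m.natAbs) :
    |srwTwist 10 3 (fun _ => (1 : ℝ)) (Pi.single (0 : Fin 10) m) 30
        - ((pTabB30 0 ^ 10 : ℚ) : ℝ) * srwI 10 3 0 0| ≤ ((envEB30 3 : ℚ) : ℝ) := by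
  have hm0 : m ≠ 0 := by
    rintro rfl
    simp at hm
  have h := abs_srwTwist_sub_lit_pow_mul_srwI_le_envelope_twoLevel_cast (d := 10) 2 (by norm_num)
    (0 : Fin 10) hm0 (30 : ℝ) 2 6 hm hp_b30 hdeltaJ_b30 hI_n3
    (ITableD10.srwI_tab_encl_d10_origin 3 (by norm_num) 0 (by norm_num)).2
  rw [← Rat.cast_pow] at h
  exact h

/-- **`|Tw_4(m e_0; 5) − p_0^{10} · I_{4,0}(0)| ≤ envEB05 4`** for EVERY `|m| ≥ 6` (`d = 10`, `p_0 = pTabB05 0`,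
`J = 1`). [cite: FitznerVanDerHofstad2016NoBLE, §5.1.1 (5.2)–(5.5) pp. 1089–1090; DLMF, §10.2.2, §10.35.2] -/
theorem srwTwist_farEnv_d10_n4_b05 (m : ℤ) (hm : 6 ≤ m.natAbs) :
    |srwTwist 10 4 (fun _ => (1 : ℝ)) (Pi.single (0 : Fin 10) m) 5
        - ((pTabB05 0 ^ 10 : ℚ) : ℝ) * srwI 10 4 0 0| ≤ ((envEB05 4 : ℚ) : ℝ) := by
  have hm0 : m ≠ 0 := by
    rintro rfl
    simp at hm
  have h := abs_srwTwist_sub_lit_pow_mul_srwI_le_envelope_twoLevel_cast (d := 10) 3 (by norm_num)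
    (0 : Fin 10) hm0 (5 : ℝ) 1 6 hm hp_b05 hdeltaJ_b05 hI_n4
    (ITableD10.srwI_tab_encl_d10_origin 4 (by norm_num) 0 (by norm_num)).2
  rw [← Rat.cast_pow] at h
  exact h

/-- **`|Tw_4(m e_0; 10) − p_0^{10} · I_{4,0}(0)| ≤ envEB10 4`** for EVERY `|m| ≥ 6` (`d = 10`, `p_0 = pTabB10 0`,
`J = 1`). [cite: FitznerVanDerHofstad2016NoBLE, §5.1.1 (5.2)–(5.5) pp. 1089–1090; DLMF, §10.2.2, §10.35.2] -/
theorem srwTwist_farEnv_d10_n4_b10 (m : ℤ) (hm : 6 ≤ m.natAbs) :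
    |srwTwist 10 4 (fun _ => (1 : ℝ)) (Pi.single (0 : Fin 10) m) 10
        - ((pTabB10 0 ^ 10 : ℚ) : ℝ) * srwI 10 4 0 0| ≤ ((envEB10 4 : ℚ) : ℝ) := by
  have hm0 : m ≠ 0 := by
    rintro rfl
    simp at hm
  have h := abs_srwTwist_sub_lit_pow_mul_srwI_le_envelope_twoLevel_cast (d := 10) 3 (by norm_num)
    (0 : Fin 10) hm0 (10 : ℝ) 1 6 hm hp_b10 hdeltaJ_b10 hI_n4
    (ITableD10.srwI_tab_encl_d10_origin 4 (by norm_num) 0 (by norm_num)).2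
  rw [← Rat.cast_pow] at h
  exact h

/-- **`|Tw_4(m e_0; 15) − p_0^{10} · I_{4,0}(0)| ≤ envEB15 4`** for EVERY `|m| ≥ 6` (`d = 10`, `p_0 = pTabB15 0`,
`J = 1`). [cite: FitznerVanDerHofstad2016NoBLE, §5.1.1 (5.2)–(5.5) pp. 1089–1090; DLMF, §10.2.2, §10.35.2] -/
theorem srwTwist_farEnv_d10_n4_b15 (m : ℤ) (hm : 6 ≤ m.natAbs) :
    |srwTwist 10 4 (fun _ => (1 : ℝ)) (Pi.single (0 : Fin 10) m) 15
        - ((pTabB15 0 ^ 10 : ℚ) : ℝ) * srwI 10 4 0 0| ≤ ((envEB15 4 : ℚ) : ℝ) := by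
  have hm0 : m ≠ 0 := by
    rintro rfl
    simp at hm
  have h := abs_srwTwist_sub_lit_pow_mul_srwI_le_envelope_twoLevel_cast (d := 10) 3 (by norm_num)
    (0 : Fin 10) hm0 (15 : ℝ) 1 6 hm hp_b15 hdeltaJ_b15 hI_n4
    (ITableD10.srwI_tab_encl_d10_origin 4 (by norm_num) 0 (by norm_num)).2
  rw [← Rat.cast_pow] at h
  exact h

/-- **`|Tw_4(m e_0; 20) − p_0^{10} · I_{4,0}(0)| ≤ envEB20 4`** for EVERY `|m| ≥ 6` (`d = 10`, `p_0 = pTabB20 0`,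
`J = 2`). [cite: FitznerVanDerHofstad2016NoBLE, §5.1.1 (5.2)–(5.5) pp. 1089–1090; DLMF, §10.2.2, §10.35.2] -/
theorem srwTwist_farEnv_d10_n4_b20 (m : ℤ) (hm : 6 ≤ m.natAbs) :
    |srwTwist 10 4 (fun _ => (1 : ℝ)) (Pi.single (0 : Fin 10) m) 20
        - ((pTabB20 0 ^ 10 : ℚ) : ℝ) * srwI 10 4 0 0| ≤ ((envEB20 4 : ℚ) : ℝ) := by
  have hm0 : m ≠ 0 := by
    rintro rfl
    simp at hm
  have h := abs_srwTwist_sub_lit_pow_mul_srwI_le_envelope_twoLevel_cast (d := 10) 3 (by norm_num)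
    (0 : Fin 10) hm0 (20 : ℝ) 2 6 hm hp_b20 hdeltaJ_b20 hI_n4
    (ITableD10.srwI_tab_encl_d10_origin 4 (by norm_num) 0 (by norm_num)).2
  rw [← Rat.cast_pow] at h
  exact h

/-- **`|Tw_4(m e_0; 25) − p_0^{10} · I_{4,0}(0)| ≤ envEB25 4`** for EVERY `|m| ≥ 6` (`d = 10`, `p_0 = pTabB25 0`,
`J = 2`). [cite: FitznerVanDerHofstad2016NoBLE, §5.1.1 (5.2)–(5.5) pp. 1089–1090; DLMF, §10.2.2, §10.35.2] -/
theorem srwTwist_farEnv_d10_n4_b25 (m : ℤ) (hm : 6 ≤ m.natAbs) :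
    |srwTwist 10 4 (fun _ => (1 : ℝ)) (Pi.single (0 : Fin 10) m) 25
        - ((pTabB25 0 ^ 10 : ℚ) : ℝ) * srwI 10 4 0 0| ≤ ((envEB25 4 : ℚ) : ℝ) := by
  have hm0 : m ≠ 0 := by
    rintro rfl
    simp at hm
  have h := abs_srwTwist_sub_lit_pow_mul_srwI_le_envelope_twoLevel_cast (d := 10) 3 (by norm_num)
    (0 : Fin 10) hm0 (25 : ℝ) 2 6 hm hp_b25 hdeltaJ_b25 hI_n4
    (ITableD10.srwI_tab_encl_d10_origin 4 (by norm_num) 0 (by norm_num)).2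
  rw [← Rat.cast_pow] at h
  exact h

/-- **`|Tw_4(m e_0; 30) − p_0^{10} · I_{4,0}(0)| ≤ envEB30 4`** for EVERY `|m| ≥ 6` (`d = 10`, `p_0 = pTabB30 0`,
`J = 2`). [cite: FitznerVanDerHofstad2016NoBLE, §5.1.1 (5.2)–(5.5) pp. 1089–1090; DLMF, §10.2.2, §10.35.2] -/
theorem srwTwist_farEnv_d10_n4_b30 (m : ℤ) (hm : 6 ≤ m.natAbs) :
    |srwTwist 10 4 (fun _ => (1 : ℝ)) (Pi.single (0 : Fin 10) m) 30
        - ((pTabB30 0 ^ 10 : ℚ) : ℝ) * srwI 10 4 0 0| ≤ ((envEB30 4 : ℚ) : ℝ) := by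
  have hm0 : m ≠ 0 := by
    rintro rfl
    simp at hm
  have h := abs_srwTwist_sub_lit_pow_mul_srwI_le_envelope_twoLevel_cast (d := 10) 3 (by norm_num)
    (0 : Fin 10) hm0 (30 : ℝ) 2 6 hm hp_b30 hdeltaJ_b30 hI_n4
    (ITableD10.srwI_tab_encl_d10_origin 4 (by norm_num) 0 (by norm_num)).2
  rw [← Rat.cast_pow] at h
  exact h

/-! ### §4. The m-uniform `K_{N,0}` far axis rows -/

/-- Six one-sided literal bounds at `β = 5, …, 30` in the `∀ r : Fin 6` shape of
`srwK_zero_single_le_uniform_gset_cast`. [folklore] -/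
private theorem abs_forall_gsetB {G : ℝ → ℝ} {S : ℝ} {c₀ c₁ c₂ c₃ c₄ c₅ e₀ e₁ e₂ e₃ e₄ e₅ : ℚ}
    (h0 : |G 5 - (c₀ : ℝ) * S| ≤ (e₀ : ℝ)) (h1 : |G 10 - (c₁ : ℝ) * S| ≤ (e₁ : ℝ))
    (h2 : |G 15 - (c₂ : ℝ) * S| ≤ (e₂ : ℝ)) (h3 : |G 20 - (c₃ : ℝ) * S| ≤ (e₃ : ℝ))
    (h4 : |G 25 - (c₄ : ℝ) * S| ≤ (e₄ : ℝ)) (h5 : |G 30 - (c₅ : ℝ) * S| ≤ (e₅ : ℝ)) :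
    ∀ r : Fin 6, |G (gsetB r) - ((![c₀, c₁, c₂, c₃, c₄, c₅] r : ℚ) : ℝ) * S|
      ≤ ((![e₀, e₁, e₂, e₃, e₄, e₅] r : ℚ) : ℝ) := by
  intro r
  fin_cases r
  · simpa [gsetB, MajCert.gset] using h0
  · simpa [gsetB, MajCert.gset] using h1
  · simpa [gsetB, MajCert.gset] using h2
  · simpa [gsetB, MajCert.gset] using h3
  · simpa [gsetB, MajCert.gset] using h4
  · simpa [gsetB, MajCert.gset] using h5

/-- [folklore] -/
private theorem ax01 : (0 : Fin 10) ≠ 1 := by decide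

/-- `[6]` is dominated coordinatewise by `12 e_0`. [folklore] -/
private theorem dom_two : ∀ μ : Fin 10,
    |clsPt 10 [6] μ| ≤ |(Pi.single (0 : Fin 10) (2 * ((6 : ℕ) : ℤ)) : Fin 10 → ℤ) μ| := by decide

/-- `[1,6]` is dominated coordinatewise by `6 e_0 + 6 e_1`. [folklore] -/
private theorem dom_pair : ∀ μ : Fin 10,
    |clsPt 10 [1, 6] μ| ≤ |(Pi.single (0 : Fin 10) ((6 : ℕ) : ℤ) + Pi.single (1 : Fin 10) ((6 : ℕ) : ℤ) : Fin 10 → ℤ) μ| := by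
  decide

/-- **`K_{2,0}(m e_i; 10) ≤ 221323 / 10⁶` for EVERY `|m| ≥ 6`** and every axis `i` (the m-uniform far row by the
envelope at `J = 1` (`β ≤ 15`) / `J = 2` (`β ≥ 20`), `M = 6`). [cite: FitznerVanDerHofstad2016NoBLE, (5.15) p. 1092, §5.1.1 (5.2)–(5.5) pp. 1089–1090] -/
theorem srwK_zero_farEnv_d10_n2 (i : Fin 10) (m : ℤ) (hm : 6 ≤ m.natAbs) :
    srwK 10 2 0 (Pi.single i m) ≤ ((221323 / 1000000 : ℚ) : ℝ) := by
  rw [apply_single_eq_of_spInvariant (F := srwK 10 2 0) (fun τ x => srwK_spAct 2 0 τ x) i 0 m]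
  exact (srwK_zero_single_le_uniform_gset_cast (d := 10) (n := 2) (by norm_num) (by norm_num) ax01 6 hm
    (ITableD10.srwI_tab_encl_d10_origin 2 (by norm_num) 0 (by norm_num))
    ((absMonotone_srwI (d := 10) (n := 2) (by norm_num) (by norm_num) 0 _ _ dom_two).trans
      (srwI_seed_encl_d10_v000001 2 (by norm_num) (by norm_num)).2)
    ((absMonotone_srwI (d := 10) (n := 2) (by norm_num) (by norm_num) 0 _ _ dom_pair).trans
      (srwI_seed_encl_d10_v100001 2 (by norm_num) (by norm_num)).2)
    (abs_forall_gsetB (srwTwist_farEnv_d10_n2_b05 m hm) (srwTwist_farEnv_d10_n2_b10 m hm) (srwTwist_farEnv_d10_n2_b15 m hm) (srwTwist_farEnv_d10_n2_b20 m hm) (srwTwist_farEnv_d10_n2_b25 m hm) (srwTwist_farEnv_d10_n2_b30 m hm))).trans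
    (Rat.cast_le.mpr (by decide +kernel))

/-- **`K_{3,0}(m e_i; 10) ≤ 277730 / 10⁶` for EVERY `|m| ≥ 6`** and every axis `i` (the m-uniform far row by the
envelope at `J = 1` (`β ≤ 15`) / `J = 2` (`β ≥ 20`), `M = 6`). [cite: FitznerVanDerHofstad2016NoBLE, (5.15) p. 1092, §5.1.1 (5.2)–(5.5) pp. 1089–1090] -/
theorem srwK_zero_farEnv_d10_n3 (i : Fin 10) (m : ℤ) (hm : 6 ≤ m.natAbs) :
    srwK 10 3 0 (Pi.single i m) ≤ ((277730 / 1000000 : ℚ) : ℝ) := by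
  rw [apply_single_eq_of_spInvariant (F := srwK 10 3 0) (fun τ x => srwK_spAct 3 0 τ x) i 0 m]
  exact (srwK_zero_single_le_uniform_gset_cast (d := 10) (n := 3) (by norm_num) (by norm_num) ax01 6 hm
    (ITableD10.srwI_tab_encl_d10_origin 3 (by norm_num) 0 (by norm_num))
    ((absMonotone_srwI (d := 10) (n := 3) (by norm_num) (by norm_num) 0 _ _ dom_two).trans
      (srwI_seed_encl_d10_v000001 3 (by norm_num) (by norm_num)).2)
    ((absMonotone_srwI (d := 10) (n := 3) (by norm_num) (by norm_num) 0 _ _ dom_pair).trans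
      (srwI_seed_encl_d10_v100001 3 (by norm_num) (by norm_num)).2)
    (abs_forall_gsetB (srwTwist_farEnv_d10_n3_b05 m hm) (srwTwist_farEnv_d10_n3_b10 m hm) (srwTwist_farEnv_d10_n3_b15 m hm) (srwTwist_farEnv_d10_n3_b20 m hm) (srwTwist_farEnv_d10_n3_b25 m hm) (srwTwist_farEnv_d10_n3_b30 m hm))).trans
    (Rat.cast_le.mpr (by decide +kernel))

/-- **`K_{4,0}(m e_i; 10) ≤ 470660 / 10⁶` for EVERY `|m| ≥ 6`** and every axis `i` (the m-uniform far row by the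
envelope at `J = 1` (`β ≤ 15`) / `J = 2` (`β ≥ 20`), `M = 6`). [cite: FitznerVanDerHofstad2016NoBLE, (5.15) p. 1092, §5.1.1 (5.2)–(5.5) pp. 1089–1090] -/
theorem srwK_zero_farEnv_d10_n4 (i : Fin 10) (m : ℤ) (hm : 6 ≤ m.natAbs) :
    srwK 10 4 0 (Pi.single i m) ≤ ((470660 / 1000000 : ℚ) : ℝ) := by
  rw [apply_single_eq_of_spInvariant (F := srwK 10 4 0) (fun τ x => srwK_spAct 4 0 τ x) i 0 m]
  exact (srwK_zero_single_le_uniform_gset_cast (d := 10) (n := 4) (by norm_num) (by norm_num) ax01 6 hm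
    (ITableD10.srwI_tab_encl_d10_origin 4 (by norm_num) 0 (by norm_num))
    ((absMonotone_srwI (d := 10) (n := 4) (by norm_num) (by norm_num) 0 _ _ dom_two).trans
      (srwI_seed_encl_d10_v000001 4 (by norm_num) (by norm_num)).2)
    ((absMonotone_srwI (d := 10) (n := 4) (by norm_num) (by norm_num) 0 _ _ dom_pair).trans
      (srwI_seed_encl_d10_v100001 4 (by norm_num) (by norm_num)).2)
    (abs_forall_gsetB (srwTwist_farEnv_d10_n4_b05 m hm) (srwTwist_farEnv_d10_n4_b10 m hm) (srwTwist_farEnv_d10_n4_b15 m hm) (srwTwist_farEnv_d10_n4_b20 m hm) (srwTwist_farEnv_d10_n4_b25 m hm) (srwTwist_farEnv_d10_n4_b30 m hm))).trans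
    (Rat.cast_le.mpr (by decide +kernel))

end FarRowEnvD10

end Literature.Probability.FitznerVanDerHofstad2017
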